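import Literature.AlgebraicGeometry.HodgeTheory.RealSl2Blocks
import Literature.AlgebraicGeometry.HodgeTheory.HOneOfProductEndomorphismBlocks
import Literature.AlgebraicGeometry.HodgeTheory.MixedPowersRetract
import Mathlib.LinearAlgebra.Charpoly.BaseChange
import Mathlib.LinearAlgebra.Eigenspace.Charpoly
import HarnessLib

/-!
# Real `𝔰𝔩₂`-block data is stable under orthogonal products: `B = D` and the Hodge conjecture for all powers and mixed powers of products of pairwise orthogonal factors (Hazama 1989; Moonen–Zarhin 1999 Thm. (3.2)(1))

Family `hodge`, layer `Literature/AlgebraicGeometry/HodgeTheory`. Research context: cell `pub-hodge-ring2`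
(HONEST FRAMING: research route conditional on HC_CM; not a corollary; Q11.4-sentence-2 already refuted in
dim ≥ 3), Literature lane, programme R3 (`pub-hodge-ring2-lit-g40/PLAN-R3.md`). UNCONDITIONAL; no definition, no
named fact; no step towards a summit statement beyond the published theorem it formalises.

PUBLISHED STATEMENT. Moonen–Zarhin, Duke Math. J. 98 (1999), Thm. (3.2)(1) (= Hazama, Duke Math. J. 58 (1989);
Gordon's survey Thm. 7.6.2): «Let `X₁` and `X₂` be complex abelian varieties which both satisfy condition (D).
(1) Suppose `X₁` and `X₂` contain no factors of Type 4. Then `X₁ × X₂` again satisfies (D), and either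
`Hom(X₁, X₂) ≠ 0` or `Hg(X₁ × X₂) = Hg(X₁) × Hg(X₂)`.»

TREE STATEMENT (for the class carrying real `𝔰𝔩₂`-block data, `RealSl2Blocks.HasRealSl2Blocks` — which contains
the abelian varieties whose `End⁰` is a totally real field of degree `dim`, and, by this file, is closed under
orthogonal products):
* `hom_prod_eq_zero_of_orthogonal`, `hom_to_prod_eq_zero_of_orthogonal` — orthogonality passes to products;
* **`HasRealSl2Blocks.prod`** — if `A`, `B` have real `𝔰𝔩₂`-block data and `Hom(A, B) = 0 = Hom(B, A)`, then
  `A × B` has real `𝔰𝔩₂`-block data (characters `τ ∘ corner_i`, blocks `pr_i^* V_τ` —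
  `HOneOfProductEndomorphismBlocks` —, Hodge-adapted bases and `θ`-classes TRANSPORTED along `pr_i^*`);
* hence (`RealSl2Blocks`, `MixedPowersRetract`) **`HasRealSl2Blocks.isStablyNondegenerate_prod`** (condition (D) for
  `A × B`), **`HasRealSl2Blocks.hodgeConjectureFor_prod_powSucc`**, **`…isDivisorGenerated_powSucc_prod_powSucc`**,
  **`…hodgeConjectureFor_powSucc_prod_powSucc`** (the Hodge conjecture for every `(A × B)^{N+1}` and every
  `A^{M+1} × B^{N+1}`, UNCONDITIONALLY), isogeny closures, and `HasRealSl2Blocks.prod₃` for three pairwise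
  orthogonal factors (any number by iteration);
* **`HasRealSl2Blocks.hasNoTypeIVFactor`** — carriers have no factor of type IV (types I–III);
* `hasRealSl2Blocks_of_isIsogenous_of_isTotallyReal` — the real-multiplication instance is isogeny-closed;
* **`HasRealSl2Blocks.mem_hodgeLie_hodge_one_iff`** — `Lie Hg(A) = 𝔰𝔭_{End⁰(A)}(H¹(A), ψ)` for every carrier and every
  polarization (the clause «`Hg(X₁ × X₂) = Hg(X₁) × Hg(X₂)`» in Lie form, once `A = X₁ × X₂` carries the product data);
  `mem_hodgeLieC_hodge_one_iff_mapsTo_of_real_characters` (complexified block form `Lie Hg_ℂ = ⊕ 𝔰𝔩(V_i)`).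

## References

* [MoonenZarhin1999LowDim] B. Moonen, Yu. Zarhin, Duke Math. J. 98 (1999), §3 Thm. (3.2)(1)
  [corpus: paper:arxiv-math_9901113 p. 6]. [cite: MoonenZarhin1999LowDim, §3 Thm. (3.2)(1)]
* [Hazama1989] F. Hazama, Duke Math. J. 58 (1989). [cite: Hazama1989, Thm. (= Gordon 7.6.2)]
* [Gordon1999HodgeAVSurvey] B. B. Gordon, *A survey of the Hodge conjecture for abelian varieties*, Thm. 7.6.2
  [corpus: paper:arxiv-alg-geom_9709030 p. 21]. [cite: Gordon1999HodgeAVSurvey, Thm. 7.6.2]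
* [Hazama1983] F. Hazama, Tôhoku Math. J. 35 (1983), §3. [cite: Hazama1983, §3 (pp. 305–306)]
* [vanGeemen1994HodgeAV] B. van Geemen, LNM 1594 (1994), §2.4–2.5, Lemma 3.7. [cite: vanGeemen1994HodgeAV, Lemma 3.7]
* [Milne1986AbelianVarieties] J. S. Milne, *Abelian varieties*, in Cornell–Silverman (1986), §12 p. 122.
  [cite: Milne1986AbelianVarieties, §12 p. 122]
* [MumfordAV1970] D. Mumford, *Abelian Varieties*, §19. [cite: MumfordAV1970, §19 (Hom(C, A × B) = Hom(C, A) ⊕ Hom(C, B))]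
* [Lange2023AbelianVarietiesC] H. Lange, *Abelian Varieties over the Complex Numbers* (2023), Prop. 1.1.8, Cor. 2.4.26.
  [cite: Lange2023AbelianVarietiesC, Prop. 1.1.8 and Cor. 2.4.26]
-/

noncomputable section

open scoped TensorProduct
open CategoryTheory CategoryTheory.Limits Module NumberField

namespace Literature.AlgebraicGeometry.HodgeTheory

open Literature.AlgebraicTopology.SingularHomology
open Literature.AlgebraicGeometry.Motives (IsSmoothProjective AbelianVariety bettiCohomology
  ofRatClassBaseChange ofRatClassBaseChange_tmul HodgeTensorFacts hodgeTensorFacts_holds)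
open Literature.Barriers.HodgeConjecture
open Literature.AlgebraicGeometry.Motives.HodgeStructure
open Literature.AlgebraicGeometry.ComplexMultiplication
open Literature.AlgebraicGeometry.Milne1999.CMTypeProducts

section Orthogonal

variable {A B C : AbelianVariety ℂ}

/-- **`Hom(A × B, C) = 0` from `Hom(A, C) = 0 = Hom(B, C)`** (`f = (pr₁ ι₁ + pr₂ ι₂) f`).
[cite: MumfordAV1970, §19 (Hom(C, A × B) = Hom(C, A) ⊕ Hom(C, B))] -/
theorem hom_prod_eq_zero_of_orthogonal (hA : ∀ f : A ⟶ C, f = 0) (hB : ∀ f : B ⟶ C, f = 0)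
    (f : A.prod B ⟶ C) : f = 0 := by
  calc f = 𝟙 _ ≫ f := (Category.id_comp f).symm
    _ = (AbelianVariety.fst A B ≫ HOneProduct.inlHom A B + AbelianVariety.snd A B ≫ HOneProduct.inrHom A B) ≫ f := by
        rw [HOneProduct.fst_inlHom_add_snd_inrHom]
    _ = AbelianVariety.fst A B ≫ (HOneProduct.inlHom A B ≫ f) + AbelianVariety.snd A B ≫ (HOneProduct.inrHom A B ≫ f) := by
        rw [Preadditive.add_comp, Category.assoc, Category.assoc]
    _ = 0 := by rw [hA (HOneProduct.inlHom A B ≫ f), hB (HOneProduct.inrHom A B ≫ f), comp_zero, comp_zero, add_zero]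

/-- **`Hom(C, A × B) = 0` from `Hom(C, A) = 0 = Hom(C, B)`.** [cite: MumfordAV1970, §19 (Hom(C, A × B) = Hom(C, A) ⊕ Hom(C, B))] -/
theorem hom_to_prod_eq_zero_of_orthogonal (hA : ∀ f : C ⟶ A, f = 0) (hB : ∀ f : C ⟶ B, f = 0)
    (f : C ⟶ A.prod B) : f = 0 :=
  AbelianVariety.prod_hom_ext (by rw [zero_comp]; exact hA _) (by rw [zero_comp]; exact hB _)

end Orthogonal

section Products

variable {A B : AbelianVariety ℂ}

/-- Hodge morphisms `f^* ⊗ ℂ` map Hodge pieces of `H¹` to Hodge pieces. [cite: VoisinHodgeI2002, §7.3.2] -/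
private theorem pull_baseChange_mem_piece {X Y : AbelianVariety ℂ} (f : Y ⟶ X) {p q : ℕ} (hpq : p + q = 1)
    (x : ℂ ⊗[ℚ] bettiCohomology X.X 1)
    (hx : x ∈ (BettiUniverse.hodge exists_isReal_hodgeModel_holds
      (AbelianVariety.isSmoothProjective_holds (A := X)) 1).piece p q) :
    (BettiUniverse.pull f.hom.hom.hom 1).baseChange ℂ x ∈
      (BettiUniverse.hodge exists_isReal_hodgeModel_holds
        (AbelianVariety.isSmoothProjective_holds (A := Y)) 1).piece p q := by
  rw [BettiUniverse.mem_hodge_piece_iff exists_isReal_hodgeModel_holds hodgePQ_independent_of_hodgeModel_holds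
    _ hpq] at hx ⊢
  have h := complexBetti_map_ofRatClassBaseChangeEquiv
    (AbelianVariety.isSmoothProjective_holds (A := Y)) (AbelianVariety.isSmoothProjective_holds (A := X))
    f.hom.hom.hom x
  rw [ofRatClassBaseChangeEquiv_apply, ofRatClassBaseChangeEquiv_apply] at h
  rw [← h]
  exact hx.map_of_isSmoothProjective AbelianVariety.isSmoothProjective_holds AbelianVariety.isSmoothProjective_holds _

/-- `ρ(f^* x) = f^*(ρ x)` on `H¹`. [cite: VoisinHodgeI2002, §7.3.2] -/
private theorem ofRat_pull_baseChange {X Y : AbelianVariety ℂ} (f : Y ⟶ X) (x : ℂ ⊗[ℚ] bettiCohomology X.X 1) :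
    ofRatClassBaseChange (Motives.ComplexPoints Y.X) 1 ((BettiUniverse.pull f.hom.hom.hom 1).baseChange ℂ x) =
      complexBetti.map f.hom.hom.hom 1 (ofRatClassBaseChange (Motives.ComplexPoints X.X) 1 x) := by
  have h := complexBetti_map_ofRatClassBaseChangeEquiv
    (AbelianVariety.isSmoothProjective_holds (A := Y)) (AbelianVariety.isSmoothProjective_holds (A := X))
    f.hom.hom.hom x
  rw [ofRatClassBaseChangeEquiv_apply, ofRatClassBaseChangeEquiv_apply] at h
  exact h.symm

/-- `ρ(f^* x) ⌣ ρ(f^* y) = f^*(ρ x ⌣ ρ y)`: the `θ`-class of a transported pair is the pull-back of the `θ`-class.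
[cite: HatcherAT2002, Prop. 3.10] -/
private theorem cupH1_pull_baseChange {X Y : AbelianVariety ℂ} (f : Y ⟶ X) (x y : ℂ ⊗[ℚ] bettiCohomology X.X 1) :
    cupH1 Y ((BettiUniverse.pull f.hom.hom.hom 1).baseChange ℂ x) ((BettiUniverse.pull f.hom.hom.hom 1).baseChange ℂ y) =
      complexBetti.map f.hom.hom.hom 2 (cupH1 X x y) := by
  rw [cupH1_apply, cupH1_apply, ofRat_pull_baseChange, ofRat_pull_baseChange]
  exact (cupProduct_map _ (rfl : 1 + 1 = 2) _ _).symm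

/-- **Real `𝔰𝔩₂`-block data is stable under orthogonal products** (Moonen–Zarhin Thm. (3.2)(1): `X₁ × X₂` again
satisfies (D) and `Hg(X₁ × X₂) = Hg(X₁) × Hg(X₂)` when `Hom(X₁, X₂) = 0`, for the class of this file): the
characters of `End⁰(A × B)` are the `τ ∘ corner_i`, their blocks the `pr_i^* V_τ` (`HOneOfProductEndomorphismBlocks`),
the Hodge-adapted bases and their `θ`-classes are transported along `pr_i^*` (pull-backs of rational `(1,1)`-classes
are rational `(1,1)`-classes). [cite: MoonenZarhin1999LowDim, §3 Thm. (3.2)(1)] [cite: Hazama1989, Thm. (= Gordon 7.6.2)]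
[cite: Hazama1983, §3 (pp. 305–306)] -/
theorem HasRealSl2Blocks.prod (hA : HasRealSl2Blocks A) (hB : HasRealSl2Blocks B) (hAB : ∀ f : A ⟶ B, f = 0)
    (hBA : ∀ g : B ⟶ A, g = 0) : HasRealSl2Blocks (A.prod B) := by
  classical
  obtain ⟨hcA, ι₁, _, _, τ₁, hreal₁, hint₁, h2₁, b₁, hb₁0, hb₁1, hθ₁⟩ := hA
  obtain ⟨hcB, ι₂, _, _, τ₂, hreal₂, hint₂, h2₂, b₂, hb₂0, hb₂1, hθ₂⟩ := hB
  have hHD : exists_isReal_hodgeModel := exists_isReal_hodgeModel_holds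
  have hI : hodgePQ_independent_of_hodgeModel := hodgePQ_independent_of_hodgeModel_holds
  have hc := endAlgebra_prod_comm_of_orthogonal hcA hcB hAB hBA
  -- the blocks of the product characters are the transported blocks
  have hblk₁ : ∀ i, (⨅ e : (A.prod B).endAlgebra, Module.End.eigenspace
      ((MulOpposite.unop (bettiRep (A.prod B) e)).baseChange ℂ)
        (((τ₁ i).comp (HOneProduct.fstAlgRingHom A B hc)) e) : Submodule ℂ _) =
      (⨅ e : A.endAlgebra, Module.End.eigenspace ((MulOpposite.unop (bettiRep A e)).baseChange ℂ) (τ₁ i e) :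
        Submodule ℂ _).map ((HOneProduct.pullFst A B).baseChange ℂ) := by
    intro i
    rw [← eigenBlock_comp_endAlgebraAlgEquivEndAlgOfComm_symm hc hHD hI]
    exact HOneProduct.eigenBlock_prodFstCharacter hHD hI hc (τ₁ i)
  have hblk₂ : ∀ j, (⨅ e : (A.prod B).endAlgebra, Module.End.eigenspace
      ((MulOpposite.unop (bettiRep (A.prod B) e)).baseChange ℂ)
        (((τ₂ j).comp (HOneProduct.sndAlgRingHom A B hc)) e) : Submodule ℂ _) =
      (⨅ e : B.endAlgebra, Module.End.eigenspace ((MulOpposite.unop (bettiRep B e)).baseChange ℂ) (τ₂ j e) :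
        Submodule ℂ _).map ((HOneProduct.pullSnd A B).baseChange ℂ) := by
    intro j
    rw [← eigenBlock_comp_endAlgebraAlgEquivEndAlgOfComm_symm hc hHD hI]
    exact HOneProduct.eigenBlock_prodSndCharacter hHD hI hc (τ₂ j)
  -- the family of characters
  let τ : ι₁ ⊕ ι₂ → ((A.prod B).endAlgebra →+* ℂ) :=
    Sum.elim (fun i => (τ₁ i).comp (HOneProduct.fstAlgRingHom A B hc))
      (fun j => (τ₂ j).comp (HOneProduct.sndAlgRingHom A B hc))
  have hτl : ∀ i, τ (Sum.inl i) = (τ₁ i).comp (HOneProduct.fstAlgRingHom A B hc) := fun i => rfl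
  have hτr : ∀ j, τ (Sum.inr j) = (τ₂ j).comp (HOneProduct.sndAlgRingHom A B hc) := fun j => rfl
  have hfun : (fun k => (⨅ e : (A.prod B).endAlgebra, Module.End.eigenspace
      ((MulOpposite.unop (bettiRep (A.prod B) e)).baseChange ℂ) (τ k e) : Submodule ℂ _)) =
      Sum.elim
        (fun i => (⨅ e : A.endAlgebra,
          Module.End.eigenspace ((MulOpposite.unop (bettiRep A e)).baseChange ℂ) (τ₁ i e) : Submodule ℂ _).map
            ((HOneProduct.pullFst A B).baseChange ℂ))
        (fun j => (⨅ e : B.endAlgebra,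
          Module.End.eigenspace ((MulOpposite.unop (bettiRep B e)).baseChange ℂ) (τ₂ j e) : Submodule ℂ _).map
            ((HOneProduct.pullSnd A B).baseChange ℂ)) := by
    funext k
    cases k with
    | inl i => rw [Sum.elim_inl, hτl, hblk₁]
    | inr j => rw [Sum.elim_inr, hτr, hblk₂]
  -- transported bases
  let e₁ : ∀ i, (⨅ e : A.endAlgebra,
      Module.End.eigenspace ((MulOpposite.unop (bettiRep A e)).baseChange ℂ) (τ₁ i e) : Submodule ℂ _) ≃ₗ[ℂ]
      (⨅ e : (A.prod B).endAlgebra, Module.End.eigenspace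
        ((MulOpposite.unop (bettiRep (A.prod B) e)).baseChange ℂ) (τ (Sum.inl i) e) : Submodule ℂ _) :=
    fun i => (Submodule.equivMapOfInjective _ HOneProduct.pullFst_baseChange_injective _).trans
      (LinearEquiv.ofEq _ _ ((hτl i).symm ▸ hblk₁ i).symm)
  let e₂ : ∀ j, (⨅ e : B.endAlgebra,
      Module.End.eigenspace ((MulOpposite.unop (bettiRep B e)).baseChange ℂ) (τ₂ j e) : Submodule ℂ _) ≃ₗ[ℂ]
      (⨅ e : (A.prod B).endAlgebra, Module.End.eigenspace
        ((MulOpposite.unop (bettiRep (A.prod B) e)).baseChange ℂ) (τ (Sum.inr j) e) : Submodule ℂ _) :=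
    fun j => (Submodule.equivMapOfInjective _ HOneProduct.pullSnd_baseChange_injective _).trans
      (LinearEquiv.ofEq _ _ ((hτr j).symm ▸ hblk₂ j).symm)
  let b : ∀ k, Module.Basis (Fin 2) ℂ (⨅ e : (A.prod B).endAlgebra, Module.End.eigenspace
      ((MulOpposite.unop (bettiRep (A.prod B) e)).baseChange ℂ) (τ k e) : Submodule ℂ _) :=
    fun k => match k with
      | Sum.inl i => (b₁ i).map (e₁ i)
      | Sum.inr j => (b₂ j).map (e₂ j)
  have hb_inl : ∀ i r, (b (Sum.inl i) r : ℂ ⊗[ℚ] bettiCohomology (A.prod B).X 1) =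
      (HOneProduct.pullFst A B).baseChange ℂ (b₁ i r : ℂ ⊗[ℚ] bettiCohomology A.X 1) := fun i r => rfl
  have hb_inr : ∀ j r, (b (Sum.inr j) r : ℂ ⊗[ℚ] bettiCohomology (A.prod B).X 1) =
      (HOneProduct.pullSnd A B).baseChange ℂ (b₂ j r : ℂ ⊗[ℚ] bettiCohomology B.X 1) := fun j r => rfl
  refine ⟨hc, ι₁ ⊕ ι₂, inferInstance, inferInstance, τ, ?_, ?_, ?_, b, ?_, ?_, ?_⟩
  · rintro (i | j)
    · rw [hτl, ← RingHom.comp_assoc, hreal₁ i]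
    · rw [hτr, ← RingHom.comp_assoc, hreal₂ j]
  · rw [hfun]
    exact HOneProduct.isInternal_sum_elim_map ((HOneProduct.pullFst A B).baseChange ℂ)
      ((HOneProduct.pullSnd A B).baseChange ℂ) ((HOneProduct.pullInl A B).baseChange ℂ)
      ((HOneProduct.pullInr A B).baseChange ℂ) HOneProduct.pullInl_pullFst_baseChange
      HOneProduct.pullInl_pullSnd_baseChange HOneProduct.pullInr_pullSnd_baseChange
      HOneProduct.pullInr_pullFst_baseChange HOneProduct.pullFst_pullInl_add_baseChange hint₁ hint₂
  · rintro (i | j)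
    · rw [hτl, hblk₁, ← h2₁ i]
      exact (Submodule.equivMapOfInjective _ HOneProduct.pullFst_baseChange_injective _).finrank_eq.symm
    · rw [hτr, hblk₂, ← h2₂ j]
      exact (Submodule.equivMapOfInjective _ HOneProduct.pullSnd_baseChange_injective _).finrank_eq.symm
  · rintro (i | j)
    · rw [hb_inl]; exact pull_baseChange_mem_piece (AbelianVariety.fst A B) (p := 1) (q := 0) rfl _ (hb₁0 i)
    · rw [hb_inr]; exact pull_baseChange_mem_piece (AbelianVariety.snd A B) (p := 1) (q := 0) rfl _ (hb₂0 j)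
  · rintro (i | j)
    · rw [hb_inl]; exact pull_baseChange_mem_piece (AbelianVariety.fst A B) (p := 0) (q := 1) rfl _ (hb₁1 i)
    · rw [hb_inr]; exact pull_baseChange_mem_piece (AbelianVariety.snd A B) (p := 0) (q := 1) rfl _ (hb₂1 j)
  · rintro (i | j)
    · rw [hb_inl, hb_inl, cupH1_pull_baseChange]
      exact map_mem_span_rational_oneOne (AbelianVariety.isSmoothProjective_holds (A := A.prod B))
        (AbelianVariety.isSmoothProjective_holds (A := A)) (AbelianVariety.fst A B).hom.hom.hom (hθ₁ i)
    · rw [hb_inr, hb_inr, cupH1_pull_baseChange]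
      exact map_mem_span_rational_oneOne (AbelianVariety.isSmoothProjective_holds (A := A.prod B))
        (AbelianVariety.isSmoothProjective_holds (A := B)) (AbelianVariety.snd A B).hom.hom.hom (hθ₂ j)

/-- **Three pairwise orthogonal factors** (any number by iteration: `hom_prod_eq_zero_of_orthogonal`,
`hom_to_prod_eq_zero_of_orthogonal`). [cite: MoonenZarhin1999LowDim, §3 Thm. (3.2)(1)] -/
theorem HasRealSl2Blocks.prod₃ {A₁ A₂ A₃ : AbelianVariety ℂ} (h₁ : HasRealSl2Blocks A₁) (h₂ : HasRealSl2Blocks A₂)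
    (h₃ : HasRealSl2Blocks A₃) (h₁₂ : ∀ f : A₁ ⟶ A₂, f = 0) (h₂₁ : ∀ f : A₂ ⟶ A₁, f = 0)
    (h₁₃ : ∀ f : A₁ ⟶ A₃, f = 0) (h₃₁ : ∀ f : A₃ ⟶ A₁, f = 0) (h₂₃ : ∀ f : A₂ ⟶ A₃, f = 0)
    (h₃₂ : ∀ f : A₃ ⟶ A₂, f = 0) : HasRealSl2Blocks ((A₁.prod A₂).prod A₃) :=
  (h₁.prod h₂ h₁₂ h₂₁).prod h₃ (hom_prod_eq_zero_of_orthogonal h₁₃ h₂₃) (hom_to_prod_eq_zero_of_orthogonal h₃₁ h₃₂)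

/-! ### Consequences for `A × B` -/

/-- **Condition (D) for `A × B`** («`X₁ × X₂` again satisfies (D)»). [cite: MoonenZarhin1999LowDim, §3 Thm. (3.2)(1)]
[cite: Hazama1989, Thm. (= Gordon 7.6.2)] [cite: Gordon1999HodgeAVSurvey, Thm. 7.6.2] -/
theorem HasRealSl2Blocks.isStablyNondegenerate_prod (hA : HasRealSl2Blocks A) (hB : HasRealSl2Blocks B)
    (hAB : ∀ f : A ⟶ B, f = 0) (hBA : ∀ g : B ⟶ A, g = 0) : IsStablyNondegenerate (A.prod B) :=
  (hA.prod hB hAB hBA).isStablyNondegenerate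

/-- **`B = D` for every `B'` with slots over `A × B`** (in particular every `(A × B)^{N+1}`).
[cite: MoonenZarhin1999LowDim, §3 Thm. (3.2)(1)] [cite: Ribet1983, Thm. 0–1] -/
theorem HasRealSl2Blocks.isDivisorGenerated_of_avSlots_prod (hA : HasRealSl2Blocks A) (hB : HasRealSl2Blocks B)
    (hAB : ∀ f : A ⟶ B, f = 0) (hBA : ∀ g : B ⟶ A, g = 0) {B' : AbelianVariety ℂ} {n : ℕ}
    {g : Fin n → (B' ⟶ A.prod B)} (hg : AVSlots (A.prod B) B' g) : IsDivisorGenerated B' :=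
  (hA.prod hB hAB hBA).isDivisorGenerated_of_avSlots hg

/-- **The Hodge conjecture for every `(A × B)^{N+1}`**, unconditionally. [cite: MoonenZarhin1999LowDim, §3 Thm. (3.2)(1)]
[cite: Hazama1989, Thm. (= Gordon 7.6.2)] -/
theorem HasRealSl2Blocks.hodgeConjectureFor_prod_powSucc (hA : HasRealSl2Blocks A) (hB : HasRealSl2Blocks B)
    (hAB : ∀ f : A ⟶ B, f = 0) (hBA : ∀ g : B ⟶ A, g = 0) (N : ℕ) :
    HodgeConjectureFor (((A.prod B).powSucc N)).dim ((A.prod B).powSucc N).X :=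
  (hA.prod hB hAB hBA).hodgeConjectureFor_powSucc N

/-- **`B = D` for every mixed power `A^{M+1} × B^{N+1}`** (a retract of `(A × B)^{max+1}`, `MixedPowersRetract`).
[cite: MoonenZarhin1999LowDim, §3 Thm. (3.2)(1)] [cite: vanGeemen1994HodgeAV, §2.4–2.5 (p. 235) and §3.6–3.7 (p. 236)] -/
theorem HasRealSl2Blocks.isDivisorGenerated_powSucc_prod_powSucc (hA : HasRealSl2Blocks A)
    (hB : HasRealSl2Blocks B) (hAB : ∀ f : A ⟶ B, f = 0) (hBA : ∀ g : B ⟶ A, g = 0) (M N : ℕ) :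
    IsDivisorGenerated ((A.powSucc M).prod (B.powSucc N)) :=
  IsDivisorGenerated.powSucc_prod_powSucc_of_forall_prod_powSucc
    (hA.prod hB hAB hBA).isDivisorGenerated_powSucc M N

/-- **The Hodge conjecture for every `A^{M+1} × B^{N+1}`**, unconditionally. [cite: MoonenZarhin1999LowDim, §3 Thm. (3.2)(1)]
[cite: Hazama1989, Thm. (= Gordon 7.6.2)] -/
theorem HasRealSl2Blocks.hodgeConjectureFor_powSucc_prod_powSucc (hA : HasRealSl2Blocks A)
    (hB : HasRealSl2Blocks B) (hAB : ∀ f : A ⟶ B, f = 0) (hBA : ∀ g : B ⟶ A, g = 0) (M N : ℕ) :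
    HodgeConjectureFor ((A.powSucc M).prod (B.powSucc N)).dim ((A.powSucc M).prod (B.powSucc N)).X :=
  hodgeConjectureFor_of_isDivisorGenerated _ (hA.isDivisorGenerated_powSucc_prod_powSucc hB hAB hBA M N)

/-- The Hodge conjecture for everything isogenous to some `A^{M+1} × B^{N+1}`. [cite: vanGeemen1994HodgeAV, Lemma 3.7]
[cite: MoonenZarhin1999LowDim, §3 Thm. (3.2)(1)] -/
theorem HasRealSl2Blocks.hodgeConjectureFor_of_isIsogenous_powSucc_prod_powSucc (hA : HasRealSl2Blocks A)
    (hB : HasRealSl2Blocks B) (hAB : ∀ f : A ⟶ B, f = 0) (hBA : ∀ g : B ⟶ A, g = 0) {X : AbelianVariety ℂ}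
    {M N : ℕ} (hX : X.IsIsogenous ((A.powSucc M).prod (B.powSucc N))) : HodgeConjectureFor X.dim X.X :=
  HodgeConjectureFor.of_isIsogenous hX (hA.hodgeConjectureFor_powSucc_prod_powSucc hB hAB hBA M N)

end Products

/-! ### Carriers have no factor of type IV -/

section NoTypeIV

variable {A : AbelianVariety ℂ}

/-- **A carrier of real `𝔰𝔩₂`-block data has no factor of type IV** (its endomorphism algebra is commutative
with totally real centre, Albert types I–III; Moonen–Zarhin §1 «no factors of Type 4»): for `z ∈ End⁰(A)` take
`f =` the characteristic polynomial of `z^*` on `H¹(A, ℚ)`; `f(z) = 0` by Cayley–Hamilton and the faithfulness of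
the rational representation; a complex root of `f` is an eigenvalue of `z^* ⊗ ℂ`, and since `H¹ ⊗ ℂ` is the direct
sum of the blocks, on which `z^*` acts by the REAL scalars `τ_i(z)`, every eigenvalue is some `τ_i(z) ∈ ℝ`.
[cite: MoonenZarhin1999LowDim, §1] [cite: Hazama1983, §3 (pp. 305–306)] [cite: Lange2023AbelianVarietiesC, Prop. 1.1.8 and Cor. 2.4.26] -/
theorem HasRealSl2Blocks.hasNoTypeIVFactor (h : HasRealSl2Blocks A) : HasNoTypeIVFactor A := by
  classical
  obtain ⟨hc, ι, _, _, τ, hreal, hint, -, -⟩ := h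
  haveI : Module.Finite ℚ (bettiCohomology A.X 1) := finite_bettiCohomology_one A
  intro z _
  refine ⟨(MulOpposite.unop (bettiRep A z)).charpoly,
    (LinearMap.charpoly_monic (MulOpposite.unop (bettiRep A z))).ne_zero, ?_, fun x hx => ?_⟩
  · -- Cayley–Hamilton through the (injective) rational representation
    have hinj : Function.Injective (bettiRepOfComm A hc) := fun a b hab => by
      rw [bettiRepOfComm_apply, bettiRepOfComm_apply] at hab
      exact bettiRep_injective (MulOpposite.unop_injective hab)
    apply hinj
    rw [← Polynomial.aeval_algHom_apply, map_zero, bettiRepOfComm_apply]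
    exact LinearMap.aeval_self_charpoly _
  · -- a complex root is an eigenvalue of `z^* ⊗ ℂ`, hence one of the real scalars `τ_i(z)`
    have hx' : ((MulOpposite.unop (bettiRep A z)).baseChange ℂ).charpoly.IsRoot x := by
      rw [LinearMap.charpoly_baseChange, Polynomial.IsRoot.def, Polynomial.eval_map_algebraMap]
      exact hx
    obtain ⟨v, hv, hv0⟩ :=
      ((Module.End.hasEigenvalue_iff_isRoot_charpoly _ x).2 hx').exists_hasEigenvector
    by_contra hxim
    have hne : ∀ i, τ i z ≠ x := by
      intro i hi
      apply hxim
      rw [← hi]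
      have h1 := RingHom.congr_fun (hreal i) z
      rw [RingHom.comp_apply] at h1
      exact Complex.conj_eq_iff_im.1 h1
    have hle : ∀ i, (⨅ e : A.endAlgebra,
        Module.End.eigenspace ((MulOpposite.unop (bettiRep A e)).baseChange ℂ) (τ i e) : Submodule ℂ _) ≤
        ⨆ (μ : ℂ) (_ : μ ≠ x), Module.End.eigenspace ((MulOpposite.unop (bettiRep A z)).baseChange ℂ) μ :=
      fun i => (iInf_le _ z).trans
        (le_iSup₂_of_le (f := fun μ (_ : μ ≠ x) =>
          Module.End.eigenspace ((MulOpposite.unop (bettiRep A z)).baseChange ℂ) μ) (τ i z) (hne i) le_rfl)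
    have htop : (⊤ : Submodule ℂ (ℂ ⊗[ℚ] bettiCohomology A.X 1)) ≤
        ⨆ (μ : ℂ) (_ : μ ≠ x), Module.End.eigenspace ((MulOpposite.unop (bettiRep A z)).baseChange ℂ) μ := by
      rw [← hint.submodule_iSup_eq_top]
      exact iSup_le hle
    have hdis := Module.End.eigenspaces_iSupIndep ((MulOpposite.unop (bettiRep A z)).baseChange ℂ) x
    exact hv0 ((Submodule.disjoint_def.1 hdis) v hv (htop Submodule.mem_top))

end NoTypeIV

/-! ### The real-multiplication instance up to isogeny -/

section Isogeny

/-- **Isogeny closure of the real-multiplication instance**: if `A'` is isogenous to an `A` whose endomorphism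
algebra is a totally real field of degree `dim A`, then `End⁰(A')` (`≅ End⁰(A)`, isogeny invariance) is a totally
real field of degree `dim A' = dim A`, so `A'` carries real `𝔰𝔩₂`-block data.
[cite: Milne1986AbelianVarieties, §12 p. 122] [cite: Hazama1983, §3 (pp. 305–306)] -/
theorem hasRealSl2Blocks_of_isIsogenous_of_isTotallyReal {A A' : AbelianVariety ℂ} (h : A'.IsIsogenous A)
    (hF : IsField A.endAlgebra) [IsTotallyReal (EndField A hF)]
    (hdeg : Module.finrank ℚ A.endAlgebra = A.dim) : HasRealSl2Blocks A' := by
  have hF' : IsField A'.endAlgebra := h.isField_endAlgebra_iff.2 hF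
  obtain ⟨e⟩ := h.nonempty_endAlgebra_algEquiv
  haveI : IsTotallyReal (EndField A' hF') :=
    IsTotallyReal.ofRingEquiv (F := EndField A hF)
      (((EndField.toEndAlgebra hF).trans e.symm.toRingEquiv).trans (EndField.toEndAlgebra hF').symm)
  exact hasRealSl2Blocks_of_isTotallyReal A' hF'
    (by rw [h.finrank_endAlgebra_eq, hdeg, AbelianVariety.dim_eq_of_isIsogenous_holds h])

end Isogeny

/-! ### The Lie algebra of the Hodge group of a carrier of real `𝔰𝔩₂`-block data -/

section LieAlgebra

variable {A : AbelianVariety ℂ}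

/-- **`Lie Hg(A) = 𝔰𝔭_{End⁰(A)}(H¹(A), ψ)` for every carrier of real `𝔰𝔩₂`-block data and EVERY polarization `ψ`**
(Hazama 1983 §3: «𝔥 = 𝔰𝔩₂ × ⋯ × 𝔰𝔩₂»; for `A = A₁ × ⋯ × A_k` a product of pairwise orthogonal carriers this is
«`Hg(X₁ × ⋯ × X_k) = Hg(X₁) × ⋯ × Hg(X_k)`», Moonen–Zarhin (3.2)(1), in Lie form): `X ∈ Lie Hg(A)` iff `X` commutes
with every `z^*`, `z ∈ End⁰(A)`, and is `ψ`-skew (the tree's R2a theorem with `hself` automatic,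
`mem_hodgeLie_iff_commute_and_skew_of_real_characters`, and Riemann for commutative `End⁰`).
[cite: Hazama1983, Thm. (1.1) and §3 (pp. 305–306)] [cite: MoonenZarhin1999LowDim, §3 Thm. (3.2)(1)] [cite: Ribet1983, Thm. 0–1] -/
theorem HasRealSl2Blocks.mem_hodgeLie_hodge_one_iff [HodgeTensorFacts.{0, 0}]
    [Module.Finite ℚ (bettiCohomology A.X 1)] (h : HasRealSl2Blocks A)
    (hHD : exists_isReal_hodgeModel) (hI : hodgePQ_independent_of_hodgeModel)
    (ψ : (BettiUniverse.hodge hHD (AbelianVariety.isSmoothProjective_holds (A := A)) 1).Polarization)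
    (X : Module.End ℚ (bettiCohomology A.X 1)) :
    X ∈ (BettiUniverse.hodge hHD (AbelianVariety.isSmoothProjective_holds (A := A)) 1).hodgeLie ↔
      (∀ z : A.endAlgebra, X * MulOpposite.unop (bettiRep A z) = MulOpposite.unop (bettiRep A z) * X) ∧
      (∀ v w, ψ.form (X v) w + ψ.form v (X w) = 0) := by
  classical
  obtain ⟨hc, ι, _, _, τ, hreal, hint, h2, -⟩ := h
  set Φ := endAlgebraAlgEquivEndAlgOfComm hc hHD hI with hΦ
  have heq : ∀ i, (BettiUniverse.hodge hHD (AbelianVariety.isSmoothProjective_holds (A := A)) 1).eigenBlock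
      ((τ i).comp Φ.symm.toRingEquiv.toRingHom) =
      ⨅ e : A.endAlgebra, Module.End.eigenspace ((MulOpposite.unop (bettiRep A e)).baseChange ℂ) (τ i e) :=
    fun i => eigenBlock_comp_endAlgebraAlgEquivEndAlgOfComm_symm hc hHD hI (τ i)
  have hfun : (fun i => (BettiUniverse.hodge hHD (AbelianVariety.isSmoothProjective_holds (A := A)) 1).eigenBlock
      ((τ i).comp Φ.symm.toRingEquiv.toRingHom)) = fun i => (⨅ e : A.endAlgebra,
        Module.End.eigenspace ((MulOpposite.unop (bettiRep A e)).baseChange ℂ) (τ i e) : Submodule ℂ _) :=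
    funext heq
  have hint' : DirectSum.IsInternal fun i =>
      (BettiUniverse.hodge hHD (AbelianVariety.isSmoothProjective_holds (A := A)) 1).eigenBlock
        ((τ i).comp Φ.symm.toRingEquiv.toRingHom) := by
    rw [hfun]; exact hint
  have h2' : ∀ i, Module.finrank ℂ
      ((BettiUniverse.hodge hHD (AbelianVariety.isSmoothProjective_holds (A := A)) 1).eigenBlock
        ((τ i).comp Φ.symm.toRingEquiv.toRingHom)) = 2 := fun i => by rw [heq]; exact h2 i
  have hn : (((1 : ℕ) : ℤ)) = 1 := by norm_num
  rw [mem_hodgeLie_iff_commute_and_skew_of_real_characters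
    (BettiUniverse.hodge hHD (AbelianVariety.isSmoothProjective_holds (A := A)) 1) hn
    (BettiUniverse.hodge_isEffective hHD (AbelianVariety.isSmoothProjective_holds (A := A)) 1) ψ _
    (fun i => comp_endAlgebraAlgEquivEndAlgOfComm_symm_isReal hc hHD hI (hreal i)) hint' h2' X]
  refine and_congr ⟨fun h z => ?_, fun h a => ?_⟩ Iff.rfl
  · have h1 := h (Φ z)
    rwa [hΦ, coe_endAlgebraAlgEquivEndAlgOfComm_apply] at h1
  · obtain ⟨z, rfl⟩ := Φ.surjective a
    rw [hΦ, coe_endAlgebraAlgEquivEndAlgOfComm_apply]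
    exact h z

/-- **Complexified block form: `Lie Hg(A)_ℂ = ⊕_i 𝔰𝔩(V_i)`** — `Y ∈ Lie Hg(A) ⊗ ℂ` iff `Y` preserves every block of the
data and is `ψ_ℂ`-skew; the blocks of `A × B` being the `pr₁^* V_i(A)` and `pr₂^* V_j(B)` (`HasRealSl2Blocks.prod`),
this is `Lie Hg(A × B)_ℂ = Lie Hg(A)_ℂ ⊕ Lie Hg(B)_ℂ`. Stated for any family of real characters of `End⁰(A)` with
two-dimensional blocks exhausting `H¹ ⊗ ℂ` (the data minus the bases). [cite: Hazama1983, §3 (pp. 305–306)]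
[cite: MoonenZarhin1999LowDim, §3 Thm. (3.2)(1)] -/
theorem mem_hodgeLieC_hodge_one_iff_mapsTo_of_real_characters [HodgeTensorFacts.{0, 0}]
    [Module.Finite ℚ (bettiCohomology A.X 1)] (hc : ∀ x y : A.endAlgebra, x * y = y * x)
    {ι : Type} [Fintype ι] [DecidableEq ι] (τ : ι → (A.endAlgebra →+* ℂ))
    (hreal : ∀ i, (starRingEnd ℂ).comp (τ i) = τ i)
    (hint : DirectSum.IsInternal fun i => (⨅ e : A.endAlgebra,
      Module.End.eigenspace ((MulOpposite.unop (bettiRep A e)).baseChange ℂ) (τ i e) : Submodule ℂ _))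
    (h2 : ∀ i, Module.finrank ℂ (⨅ e : A.endAlgebra,
      Module.End.eigenspace ((MulOpposite.unop (bettiRep A e)).baseChange ℂ) (τ i e) : Submodule ℂ _) = 2)
    (hHD : exists_isReal_hodgeModel) (hI : hodgePQ_independent_of_hodgeModel)
    (ψ : (BettiUniverse.hodge hHD (AbelianVariety.isSmoothProjective_holds (A := A)) 1).Polarization)
    (Y : Module.End ℂ (ℂ ⊗[ℚ] bettiCohomology A.X 1)) :
    Y ∈ (BettiUniverse.hodge hHD (AbelianVariety.isSmoothProjective_holds (A := A)) 1).hodgeLieC ↔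
      (∀ i, Set.MapsTo Y
        (⨅ e : A.endAlgebra, Module.End.eigenspace ((MulOpposite.unop (bettiRep A e)).baseChange ℂ) (τ i e) :
          Submodule ℂ _)
        (⨅ e : A.endAlgebra, Module.End.eigenspace ((MulOpposite.unop (bettiRep A e)).baseChange ℂ) (τ i e) :
          Submodule ℂ _)) ∧
      (∀ x y, ψ.form.baseChange ℂ (Y x) y + ψ.form.baseChange ℂ x (Y y) = 0) := by
  classical
  have heq : ∀ i, (BettiUniverse.hodge hHD (AbelianVariety.isSmoothProjective_holds (A := A)) 1).eigenBlock
      ((τ i).comp (endAlgebraAlgEquivEndAlgOfComm hc hHD hI).symm.toRingEquiv.toRingHom) =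
      ⨅ e : A.endAlgebra, Module.End.eigenspace ((MulOpposite.unop (bettiRep A e)).baseChange ℂ) (τ i e) :=
    fun i => eigenBlock_comp_endAlgebraAlgEquivEndAlgOfComm_symm hc hHD hI (τ i)
  have hfun : (fun i => (BettiUniverse.hodge hHD (AbelianVariety.isSmoothProjective_holds (A := A)) 1).eigenBlock
      ((τ i).comp (endAlgebraAlgEquivEndAlgOfComm hc hHD hI).symm.toRingEquiv.toRingHom)) = fun i => (⨅ e : A.endAlgebra,
        Module.End.eigenspace ((MulOpposite.unop (bettiRep A e)).baseChange ℂ) (τ i e) : Submodule ℂ _) :=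
    funext heq
  have hint' : DirectSum.IsInternal fun i =>
      (BettiUniverse.hodge hHD (AbelianVariety.isSmoothProjective_holds (A := A)) 1).eigenBlock
        ((τ i).comp (endAlgebraAlgEquivEndAlgOfComm hc hHD hI).symm.toRingEquiv.toRingHom) := by
    rw [hfun]; exact hint
  have h2' : ∀ i, Module.finrank ℂ
      ((BettiUniverse.hodge hHD (AbelianVariety.isSmoothProjective_holds (A := A)) 1).eigenBlock
        ((τ i).comp (endAlgebraAlgEquivEndAlgOfComm hc hHD hI).symm.toRingEquiv.toRingHom)) = 2 := fun i => by rw [heq]; exact h2 i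
  have hn : (((1 : ℕ) : ℤ)) = 1 := by norm_num
  rw [mem_hodgeLieC_iff_mapsTo_and_skew_of_real_characters
    (BettiUniverse.hodge hHD (AbelianVariety.isSmoothProjective_holds (A := A)) 1) hn
    (BettiUniverse.hodge_isEffective hHD (AbelianVariety.isSmoothProjective_holds (A := A)) 1) ψ _
    (fun i => comp_endAlgebraAlgEquivEndAlgOfComm_symm_isReal hc hHD hI (hreal i)) hint' h2' Y]
  simp only [heq]

end LieAlgebra

end Literature.AlgebraicGeometry.HodgeTheory

end
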